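import Summits.BirchSwinnertonDyer.BirchSwinnertonDyer.Theorems.ResidualThetaTransportAtTwoResidualSignedLambdaLowerCMAtTwoFourTermDuality
import Literature.NumberTheory.GaloisCohomology.BrauerSumTwoTorsionAtOnePlace
import Literature.NumberTheory.GaloisRepresentations.UnramifiedCupProductZero
import Literature.NumberTheory.GaloisRepresentations.CoinducedDiscreteGaloisModule
import Literature.NumberTheory.GaloisRepresentations.ContinuousShapiroLiftVanishing
import Literature.NumberTheory.GaloisRepresentations.ContinuousShapiroLiftRestrictHom
import Literature.NumberTheory.GaloisRepresentations.ContinuousCupProductCompat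
import Literature.NumberTheory.GaloisRepresentations.ContinuousCorestriction
import Mathlib.Algebra.Module.CharacterModule
import HarnessLib

/-!
# Stub-ideation sketch (k = 1, gen 10) for `stub_cmLambdaLower` of line `bt26_lambda` — the INTERIOR of the fifth stub
# `stub_reciprocity` (EH) of the lead's v2 cut, by WEAKEN / STRENGTHEN

Route `ResidualThetaTransportAtTwo`, crux item stmt-BirchSwinnertonDyer-26074 (`ResidualThetaCountLowerPureAtTwo`), stub
`stub_cmLambdaLower` = route item RSL_g (22608).  Seat `sidea-stub_cmLambdaLower-1-g10`.  HONEST FRAMING: scratch file of a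
stub-ideation seat; proves only generic algebra / reciprocity bookkeeping; `sorry` only in the helper SIGNATURES of §S;
closes no item; BSD is NOT proved by any of this.

* §A (PROVED) the RESCALING ADAPTER: the landed N5 entry `CharIdealLambda.le_finrank_baseChange_characterModule_of_duality_decorated`
  (p664041) — and hence `LambdaLowerBoundO.cmLambdaLower_of_dualityData_onePair` (p673478) — only needs the WEAK exact half
  `(EH_N) ∃ N ≠ 0, ∀ z ∈ Z, N • pair (locd z) = 0` (replace `pair` by `N • pair`; (ORTH) is inherited, (DH) keeps its slack `a ↦ a·N`,
  the three counts do not see `pair`).  So the fifth stub may be registered as `2 • pair (locd x) s = 0` (EH₂).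
* §B (PROVED) the multi-place Brauer sum: `2 • Σ_{v ∈ T} inv_v(loc_v c) = 0` for `c ∈ H²(Γ_K, μₙ)` with invariants vanishing at the
  finite places outside `T` (real places contribute `2`-torsion), and the exact form `Σ_{v∈T} inv_v = −Σ_{w∣∞} inv_w`.
* §Z (PROVED) `N • t = 0` in `ℤ/p^k` ⇒ `N • (t.val • p^{-k}) = 0` in `ℚ/ℤ` (the (C3) value currency).
* §S the helper lemmas of the plans: U (PROVED: unramified ⊥ unramified at the localisation of a cup product, 2-primary `μ` at
  `v ∤ 2`), AR (PROVED: the archimedean cup term dies when one factor dies at the real place) + the PLAN 2 exact composition (PROVED),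
  ShU (SIGNATURE: a Shapiro lift whose conjugates are principal on inertia localises into `H¹_ur`), M (SIGNATURE: Mackey — restriction
  of a Shapiro cup class along `θ : D → G`, `N ⊴ G`, ALL double cosets), and the composed PLAN 1 core identity P3
  `2 • Σ_{v∈T} inv_v loc_v (Sh ψ₁ ∪ Sh ψ₂) = 0` (PROVED from U + ShU + §B; `sorry` only inside the two signatures ShU, M).
  `lean check --json`: rc 0, errors [], sorries = 2 (ShU, M), 16 declarations.
-/

noncomputable section

open CategoryTheory Function Field NumberField IsDedekindDomain
open scoped NumberField TensorProduct

namespace Summit.BirchSwinnertonDyer.BirchSwinnertonDyer.Cruxes.ResidualThetaCountLowerPureAtTwo.StubIdeasK1G10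

open _root_.ContinuousCohomology _root_.TopRep
open Literature.NumberTheory.GaloisRepresentations
open Literature.NumberTheory.GaloisRepresentations.DiscreteGaloisModule
open Literature.NumberTheory.GaloisCohomology

universe u v w

/-! ## §A The rescaling adapter (PLAN 1: the `2 •`-form of (EH) suffices for `_of`) -/

section Adapter

variable {A : Type u} [CommRing A]
  {Sel : Type v} [AddCommGroup Sel] [Module A Sel]
  {P : Type v} [AddCommGroup P] [Module A P]
  {H : Type v} [AddCommGroup H] [Module A H]
  (pair : P →ₗ[A] CharacterModule Sel) (locd : H →ₗ[A] P) (Z : Submodule A H) (Sel₀ : Submodule A Sel)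

/-- (EH_N) for `pair` is (EH) for `N • pair`. [folklore] -/
theorem eh_smul (N : A) (hEH : ∀ z ∈ Z, N • pair (locd z) = 0) : ∀ z ∈ Z, (N • pair) (locd z) = 0 := by
  intro z hz
  rw [LinearMap.smul_apply]
  exact hEH z hz

/-- (ORTH) for `pair` gives (ORTH) for `N • pair` (`Sel₀` is a submodule). [folklore] -/
theorem orth_smul (N : A) (horth : ∀ s ∈ Sel₀, ∀ z : P, pair z s = 0) : ∀ s ∈ Sel₀, ∀ z : P, (N • pair) z s = 0 := by
  intro s hs z
  rw [LinearMap.smul_apply, CharacterModule.smul_apply]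
  exact horth _ (Sel₀.smul_mem N hs) z

/-- (DH) for `pair` gives (DH) for `N • pair`, `N ≠ 0`, with slack `a ↦ a * N` (domain). [folklore] -/
theorem dh_smul [NoZeroDivisors A] {N : A} (hN : N ≠ 0)
    (hDH : ∀ z : P, pair z = 0 → ∃ a : A, a ≠ 0 ∧ ∃ x : H, a • z = locd x) :
    ∀ z : P, (N • pair) z = 0 → ∃ a : A, a ≠ 0 ∧ ∃ x : H, a • z = locd x := by
  intro z hz
  rw [LinearMap.smul_apply, ← map_smul] at hz
  obtain ⟨a, ha, x, hx⟩ := hDH (N • z) hz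
  exact ⟨a * N, mul_ne_zero ha hN, x, by rw [mul_smul]; exact hx⟩

/-- **PLAN 1 certificate.** The decoration-tolerant N5 bound of p664041 with (EH) WEAKENED to (EH_N): `∃ N ≠ 0` killing
`pair ∘ locd` on `Z`.  Proof: apply the landed theorem to `N • pair`. [cite: Kobayashi2003, Thm. 7.3 ((7.21), p. 13)] -/
theorem le_finrank_baseChange_characterModule_of_duality_decorated_of_smul
    (K : Type w) [Field K] [Algebra A K] [IsFractionRing A K]
    {H2 : Type v} [AddCommGroup H2] [Module A H2] {N : A} (hN : N ≠ 0)
    (hEH : ∀ z ∈ Z, N • pair (locd z) = 0) (horth : ∀ s ∈ Sel₀, ∀ z : P, pair z s = 0)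
    (hDH : ∀ z : P, pair z = 0 → ∃ a : A, a ≠ 0 ∧ ∃ x : H, a • z = locd x)
    [Module.Finite K (K ⊗[A] (H ⧸ Z))] [Module.Finite K (K ⊗[A] (P ⧸ Z.map locd))]
    [Module.Finite K (K ⊗[A] CharacterModule Sel)] {d e : ℕ}
    (hi : d + e ≤ Module.finrank K (K ⊗[A] (P ⧸ Z.map locd)))
    (hii : Module.finrank K (K ⊗[A] (H ⧸ Z)) ≤ Module.finrank K (K ⊗[A] H2) + e)
    (hPT : Module.finrank K (K ⊗[A] H2) ≤ Module.finrank K (K ⊗[A] CharacterModule Sel₀)) :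
    d ≤ Module.finrank K (K ⊗[A] CharacterModule Sel) := by
  haveI : NoZeroDivisors A :=
    (IsFractionRing.injective A K).noZeroDivisors (algebraMap A K) (map_zero _) (map_mul _)
  exact Theorems.CharIdealLambda.le_finrank_baseChange_characterModule_of_duality_decorated K (N • pair) locd Z Sel₀
    (eh_smul pair locd Z N hEH) (orth_smul pair Sel₀ N horth) (dh_smul pair locd hN hDH) hi hii hPT

/-- **The `2 •` form (EH₂)** — the shape PLAN 1 registers for the fifth stub: `2 • pair (locd z) = 0` on `Z` suffices as soon as
`(2 : A) ≠ 0` (true for `A = 𝒪 ⊂ ℚ̄₂`). [cite: Kobayashi2003, Thm. 7.3 ((7.21), p. 13)] -/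
theorem le_finrank_baseChange_characterModule_of_duality_decorated_of_two_nsmul
    (K : Type w) [Field K] [Algebra A K] [IsFractionRing A K]
    {H2 : Type v} [AddCommGroup H2] [Module A H2] (h2 : (2 : A) ≠ 0)
    (hEH : ∀ z ∈ Z, 2 • pair (locd z) = 0) (horth : ∀ s ∈ Sel₀, ∀ z : P, pair z s = 0)
    (hDH : ∀ z : P, pair z = 0 → ∃ a : A, a ≠ 0 ∧ ∃ x : H, a • z = locd x)
    [Module.Finite K (K ⊗[A] (H ⧸ Z))] [Module.Finite K (K ⊗[A] (P ⧸ Z.map locd))]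
    [Module.Finite K (K ⊗[A] CharacterModule Sel)] {d e : ℕ}
    (hi : d + e ≤ Module.finrank K (K ⊗[A] (P ⧸ Z.map locd)))
    (hii : Module.finrank K (K ⊗[A] (H ⧸ Z)) ≤ Module.finrank K (K ⊗[A] H2) + e)
    (hPT : Module.finrank K (K ⊗[A] H2) ≤ Module.finrank K (K ⊗[A] CharacterModule Sel₀)) :
    d ≤ Module.finrank K (K ⊗[A] CharacterModule Sel) :=
  le_finrank_baseChange_characterModule_of_duality_decorated_of_smul pair locd Z Sel₀ K h2
    (fun z hz ↦ by rw [two_smul, ← two_nsmul]; exact hEH z hz) horth hDH hi hii hPT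

end Adapter

/-! ## §Z The (C3) value currency: `ℤ/p^k → ℚ/ℤ`, `t ↦ t.val • p^{-k}` -/

section Circle

/-- `N • t = 0` in `ℤ/p^k` forces `N • (t.val • p^{-k}) = 0` in `ℚ/ℤ` (`p^{-k}` has additive order `p^k`). [folklore] -/
theorem nsmul_val_smul_invPow_eq_zero {p : ℕ} [Fact p.Prime] (k N : ℕ) (t : ZMod (p ^ k)) (h : N • t = 0) :
    N • (t.val • ((((p : ℚ) ^ k)⁻¹ : ℚ) : AddCircle (1 : ℚ))) = 0 := by
  haveI : NeZero (p ^ k) := ⟨pow_ne_zero k (Fact.out : p.Prime).ne_zero⟩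
  have hord : addOrderOf ((((p : ℚ) ^ k)⁻¹ : ℚ) : AddCircle (1 : ℚ)) = p ^ k := by
    have hpos : 0 < p ^ k := pow_pos (Fact.out : p.Prime).pos k
    have h1 := AddCircle.addOrderOf_div_of_gcd_eq_one (p := (1 : ℚ)) (m := 1) hpos (Nat.gcd_one_left _)
    simpa [one_div] using h1
  have hdvd : p ^ k ∣ N * t.val := by
    rw [← ZMod.natCast_eq_zero_iff, Nat.cast_mul, ZMod.natCast_zmod_val, ← nsmul_eq_mul]
    exact h
  rw [smul_smul]
  apply addOrderOf_dvd_iff_nsmul_eq_zero.mp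
  rw [hord]
  exact hdvd

/-- The exact form: `t = 0` ⇒ `t.val • p^{-k} = 0`. [folklore] -/
theorem val_smul_invPow_eq_zero {p : ℕ} (k : ℕ) (t : ZMod (p ^ k)) (h : t = 0) :
    t.val • ((((p : ℚ) ^ k)⁻¹ : ℚ) : AddCircle (1 : ℚ)) = 0 := by
  subst h
  rw [ZMod.val_zero, zero_smul]

end Circle

/-! ## §B The multi-place Brauer sum over a number field (PLAN 1/3: real places are `2`-torsion) -/

section Brauer

variable (K : Type) [Field K] [NumberField K] (n : ℕ) [NeZero n]

/-- **`Σ_{v ∈ T} inv_v(loc_v c) = −Σ_{w ∣ ∞} inv_w(loc_w c)`** for `c ∈ H²(Γ_K, μₙ)` whose invariants vanish at the finite places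
outside the finite set `T` (Tate's reciprocity law for THE invariant maps, `sumInvLocalizationEqZero_canonical_of_numberField`).
[cite: CasselsFrohlichANT1967, Ch. VII §11] [cite: MilneADT2006, Ch. I, Thm. 4.10(b)] -/
theorem sum_localInvariantMap_eq_neg_sum_archimedean (T : Finset (HeightOneSpectrum (𝓞 K))) (c : galoisCohomology (mu K n) 2)
    (h : ∀ v : HeightOneSpectrum (𝓞 K), v ∉ T →
      localInvariantMap K n v (galoisCohomology.localization (mu K n) (Sum.inr v) 2 c) = 0) :
    ∑ v ∈ T, localInvariantMap K n v (galoisCohomology.localization (mu K n) (Sum.inr v) 2 c) =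
      -∑ w : InfinitePlace K, archimedeanInvariantMap K n w (galoisCohomology.localization (mu K n) (Sum.inl w) 2 c) := by
  classical
  let S : Finset (Place K) := (Finset.univ.image Sum.inl) ∪ T.image Sum.inr
  have hS : ∀ v ∉ S, LocalInvariants.canonical K n v (galoisCohomology.localization (mu K n) v 2 c) = 0 := by
    rintro (w | v) hv
    · exact absurd (Finset.mem_union_left _ (Finset.mem_image_of_mem _ (Finset.mem_univ w))) hv
    · have hne : v ∉ T := fun e ↦ hv (Finset.mem_union_right _ (Finset.mem_image_of_mem _ e))
      rw [LocalInvariants.canonical_inr]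
      exact h v hne
  have hsum := sumInvLocalizationEqZero_canonical_of_numberField K n c S hS
  have hdisj : Disjoint (Finset.univ.image Sum.inl : Finset (Place K)) (T.image Sum.inr) := by
    rw [Finset.disjoint_left]
    intro x hx hx'
    simp only [Finset.mem_image, Finset.mem_univ, true_and] at hx hx'
    obtain ⟨w, rfl⟩ := hx
    obtain ⟨v, _, hv⟩ := hx'
    exact Sum.inr_ne_inl hv
  rw [Finset.sum_union hdisj, Finset.sum_image (fun _ _ _ _ e ↦ Sum.inl_injective e),
    Finset.sum_image (fun _ _ _ _ e ↦ Sum.inr_injective e)] at hsum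
  simp only [LocalInvariants.canonical_inr, LocalInvariants.canonical_inl] at hsum
  exact eq_neg_of_add_eq_zero_right hsum

/-- **`2 • Σ_{v ∈ T} inv_v(loc_v c) = 0`**: the archimedean invariants are `2`-torsion (`two_nsmul_archimedeanInvariantMap`).
The multi-place generalisation of the tree's `two_nsmul_localInvariantMap_eq_zero_of_forall_ne` (`T = {v₀}`).
[cite: CasselsFrohlichANT1967, Ch. VII §11] [cite: MilneADT2006, Ch. I, Thm. 4.10(b) and Ex. 1.6 (c)] -/
theorem two_nsmul_sum_localInvariantMap_eq_zero (T : Finset (HeightOneSpectrum (𝓞 K))) (c : galoisCohomology (mu K n) 2)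
    (h : ∀ v : HeightOneSpectrum (𝓞 K), v ∉ T →
      localInvariantMap K n v (galoisCohomology.localization (mu K n) (Sum.inr v) 2 c) = 0) :
    2 • ∑ v ∈ T, localInvariantMap K n v (galoisCohomology.localization (mu K n) (Sum.inr v) 2 c) = 0 := by
  rw [sum_localInvariantMap_eq_neg_sum_archimedean K n T c h, smul_neg, Finset.smul_sum, neg_eq_zero]
  refine Finset.sum_eq_zero fun w _ ↦ ?_
  apply two_nsmul_archimedeanInvariantMap

/-- **Exact form** (PLAN 2): if moreover the archimedean invariants of `c` vanish, `Σ_{v ∈ T} inv_v(loc_v c) = 0`.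
[cite: MilneADT2006, Ch. I, Thm. 4.10(b)] -/
theorem sum_localInvariantMap_eq_zero_of_archimedean (T : Finset (HeightOneSpectrum (𝓞 K))) (c : galoisCohomology (mu K n) 2)
    (h : ∀ v : HeightOneSpectrum (𝓞 K), v ∉ T →
      localInvariantMap K n v (galoisCohomology.localization (mu K n) (Sum.inr v) 2 c) = 0)
    (hinf : ∀ w : InfinitePlace K, archimedeanInvariantMap K n w (galoisCohomology.localization (mu K n) (Sum.inl w) 2 c) = 0) :
    ∑ v ∈ T, localInvariantMap K n v (galoisCohomology.localization (mu K n) (Sum.inr v) 2 c) = 0 := by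
  rw [sum_localInvariantMap_eq_neg_sum_archimedean K n T c h, neg_eq_zero]
  exact Finset.sum_eq_zero fun w _ ↦ hinf w

end Brauer

/-! ## §S Helper SIGNATURES of the plans (sorried; to be proved by the stub prover / critic's choice) -/

section Helpers

variable (K : Type) [Field K] [NumberField K] (n : ℕ) [NeZero n]

/-- **(U) unramified ⊥ unramified, LOCALISED** (PLAN 3 brick, PROVED: `ContPairing.cupProduct_res` + the tree's
`ContPairing.cupProduct_eq_zero_of_mem_unramifiedSubgroup`, Milne ADT I 2.6): for discrete `Γ_K`-modules `ρ₁, ρ₂`, a pairing into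
`μₙ` with `n` a power of `p`, and global classes `a, b` whose localisations at the finite place `v` are unramified, the localisation
at `v` of `a ∪ b` vanishes. [cite: MilneADT2006, Ch. I, Thm. 2.6] -/
theorem helper_localization_cupProduct_eq_zero_of_unramified {p : ℕ} [Fact p.Prime] (hn : ∃ r : ℕ, n = p ^ r)
    {M₁ M₂ : Type} [AddCommGroup M₁] [TopologicalSpace M₁] [DiscreteTopology M₁]
    [AddCommGroup M₂] [TopologicalSpace M₂] [DiscreteTopology M₂]
    (ρ₁ : DiscreteGaloisModule K M₁) (ρ₂ : DiscreteGaloisModule K M₂) [CompactSpace (absoluteGaloisGroup K)]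
    (P : ContPairing ρ₁.toTopRep ρ₂.toTopRep (mu K n).toTopRep) (v : HeightOneSpectrum (𝓞 K))
    (a : galoisCohomology ρ₁ 1) (b : galoisCohomology ρ₂ 1)
    (ha : galoisCohomology.localization ρ₁ (Sum.inr v) 1 a ∈ unramifiedSubgroup (GaloisRep.toLocal v ρ₁) 1)
    (hb : galoisCohomology.localization ρ₂ (Sum.inr v) 1 b ∈ unramifiedSubgroup (GaloisRep.toLocal v ρ₂) 1) :
    galoisCohomology.localization (mu K n) (Sum.inr v) 2 (P.cupProduct a b) = 0 := by
  obtain ⟨r, rfl⟩ := hn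
  have hC : IsPrimaryTorsion p (MuCarrier K (p ^ r)) := fun m ↦ ⟨r, by
    rw [← natCast_zsmul]
    exact zsmul_muCarrier_eq_zero K (p ^ r) m⟩
  haveI : CompactSpace (absoluteGaloisGroup (v.adicCompletion K)) := absoluteGaloisGroup_compactSpace _
  have e := ContPairing.cupProduct_res P (absGaloisRestrict K (v.adicCompletion K)) a b
  refine e.trans ?_
  exact ContPairing.cupProduct_eq_zero_of_mem_unramifiedSubgroup (ρ₁ := GaloisRep.toLocal v ρ₁) (ρ₂ := GaloisRep.toLocal v ρ₂)
    (ρ₃ := GaloisRep.toLocal v (mu K (p ^ r))) hC (P.restrict (absGaloisRestrict K (v.adicCompletion K))) ha hb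

omit [NeZero n] in
/-- **(AR) archimedean cup terms vanish when one factor dies at the real place** (PLAN 2 brick, PROVED): if
`loc_w b = 0` at the infinite place `w` (for `b = Sh ỹ` this is `map_shapiroLift_eq_zero_of_reps` along
`θ_w : Γ_{K_w} → Γ_K` fed by `H¹(⟨c⟩, A_g[ϖ^k]) = 0` — on the habitat `Δ_W < 0` makes `ρ̄(c)` the regular involution, so
`A_g[ϖ^k]` is an induced `C₂`-module: card k2-g9's S-A/G3, finite-level form), then `loc_w(a ∪ b) = 0`.
[cite: MilneADT2006, Ch. I, Thm. 4.10(b)] [cite: SerreLocalFields1979, VII §5–§6] -/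
theorem localization_inl_cupProduct_eq_zero_of_h1_trivial
    {M₁ M₂ : Type} [AddCommGroup M₁] [TopologicalSpace M₁] [DiscreteTopology M₁]
    [AddCommGroup M₂] [TopologicalSpace M₂] [DiscreteTopology M₂]
    (ρ₁ : DiscreteGaloisModule K M₁) (ρ₂ : DiscreteGaloisModule K M₂) [CompactSpace (absoluteGaloisGroup K)]
    (P : ContPairing ρ₁.toTopRep ρ₂.toTopRep (mu K n).toTopRep) (w : InfinitePlace K)
    (a : galoisCohomology ρ₁ 1) (b : galoisCohomology ρ₂ 1)
    (hb0 : galoisCohomology.localization ρ₂ (Sum.inl w) 1 b = 0) :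
    galoisCohomology.localization (mu K n) (Sum.inl w) 2 (P.cupProduct a b) = 0 := by
  haveI : CompactSpace (absoluteGaloisGroup (Place.Completion (Sum.inl w : Place K))) := absoluteGaloisGroup_compactSpace _
  have e := ContPairing.cupProduct_res P (absGaloisRestrict K (Place.Completion (Sum.inl w : Place K))) a b
  refine e.trans ?_
  have hb : ContinuousCohomology.map (absGaloisRestrict K (Place.Completion (Sum.inl w : Place K)))
      (𝟙 (TopRep.res (absGaloisRestrict K (Place.Completion (Sum.inl w : Place K)) :
        absoluteGaloisGroup (Place.Completion (Sum.inl w : Place K)) →* absoluteGaloisGroup K) ρ₂.toTopRep)) 1 b = 0 := hb0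
  rw [hb]
  exact map_zero _

/-- **PLAN 2 composed (exact form):** with invariants vanishing at the finite places outside `T` and the real `H¹` of the second
factor trivial at every infinite place, `Σ_{v ∈ T} inv_v loc_v (a ∪ b) = 0` on the nose. [cite: MilneADT2006, Ch. I, Thm. 4.10(b)] -/
theorem sum_localInvariantMap_cupProduct_eq_zero_of_real_h1_trivial
    {M₁ M₂ : Type} [AddCommGroup M₁] [TopologicalSpace M₁] [DiscreteTopology M₁]
    [AddCommGroup M₂] [TopologicalSpace M₂] [DiscreteTopology M₂]
    (ρ₁ : DiscreteGaloisModule K M₁) (ρ₂ : DiscreteGaloisModule K M₂) [CompactSpace (absoluteGaloisGroup K)]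
    (P : ContPairing ρ₁.toTopRep ρ₂.toTopRep (mu K n).toTopRep) (T : Finset (HeightOneSpectrum (𝓞 K)))
    (a : galoisCohomology ρ₁ 1) (b : galoisCohomology ρ₂ 1)
    (h : ∀ v : HeightOneSpectrum (𝓞 K), v ∉ T →
      localInvariantMap K n v (galoisCohomology.localization (mu K n) (Sum.inr v) 2 (P.cupProduct a b)) = 0)
    (hb0 : ∀ w : InfinitePlace K, galoisCohomology.localization ρ₂ (Sum.inl w) 1 b = 0) :
    ∑ v ∈ T, localInvariantMap K n v (galoisCohomology.localization (mu K n) (Sum.inr v) 2 (P.cupProduct a b)) = 0 :=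
  sum_localInvariantMap_eq_zero_of_archimedean K n T _ h fun w ↦ by
    rw [localization_inl_cupProduct_eq_zero_of_h1_trivial K n ρ₁ ρ₂ P w a b (hb0 w), map_zero]

/-- **(ShU) a Shapiro lift localises into `H¹_ur(K_v, Maps(Γ_K ⧸ U, M))`** as soon as every conjugate `d ↦ ψ(s(y₀)⁻¹ d s(y₀))`
is principal on the INERTIA elements at `v` (the inertia variant of the tree's `map_shapiroLift_eq_zero_of_reps`, which is stated
for an arbitrary `θ : D →ₜ* G`; take `θ = Γ_{K_v^{nr}} → Γ_K`). [cite: NeukirchSchmidtWingberg2008, I §5 (1.5.6)–(1.5.7), I §6 (1.6.4)] -/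
theorem helper_localization_shapiroLift_mem_unramifiedSubgroup
    {M : Type} [AddCommGroup M] [TopologicalSpace M] [DiscreteTopology M] (ρ : DiscreteGaloisModule K M)
    (U : Subgroup (absoluteGaloisGroup K)) (hU : IsOpen (U : Set (absoluteGaloisGroup K)))
    [Fintype (absoluteGaloisGroup K ⧸ U)]
    {s : absoluteGaloisGroup K ⧸ U → absoluteGaloisGroup K} (hs : ∀ x, (s x : absoluteGaloisGroup K ⧸ U) = x)
    (hs1 : s ((1 : absoluteGaloisGroup K) : absoluteGaloisGroup K ⧸ U) = 1) (v : HeightOneSpectrum (𝓞 K))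
    (ψ : contOneCocycles (subgroupRep ρ.toTopRep U))
    (hinert : ∀ y₀ : absoluteGaloisGroup K ⧸ U, ∃ b : M, ∀ i : absoluteGaloisGroup (v.adicCompletion K),
      i ∈ (IsNonarchimedeanLocalField.maxUnramified (v.adicCompletion K)).fixingSubgroup →
      ∀ hd : (s y₀)⁻¹ * absGaloisRestrict K (v.adicCompletion K) i * s y₀ ∈ U,
        ψ.1 ⟨(s y₀)⁻¹ * absGaloisRestrict K (v.adicCompletion K) i * s y₀, hd⟩ =
          ρ.toTopRep.ρ ((s y₀)⁻¹ * absGaloisRestrict K (v.adicCompletion K) i * s y₀) b - b) :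
    galoisCohomology.localization (ρ.coind U hU) (Sum.inr v) 1
        (shapiroLift ρ.toTopRep U hU hs hs1 (oneCocycleClass _ ψ)) ∈
      unramifiedSubgroup (GaloisRep.toLocal v (ρ.coind U hU)) 1 := by
  sorry

/-- **(M) Mackey, all double cosets, `N ⊴ G`** (PLAN 3 brick at the places of `S₀` and at `2`; generalises the tree's one-coset
`map_cupProduct_coindFin_shapiroLift`): along `θ : D →ₜ* G` the restriction of the summed cup product of two Shapiro lifts is the SUM,
over representatives `t i` of the `(θ(D)N)`-cosets, of the `D`-Shapiro cup products of the restricted CONJUGATE classes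
(both factors conjugated by the same `t i`). [cite: Brown1982, III §5 (5.6)(b)] [cite: NeukirchSchmidtWingberg2008, I §5 (1.5.6)–(1.5.7)] -/
theorem helper_mackey_cupProduct_shapiroLift {R : Type} [CommRing R] [TopologicalSpace R]
    {G : Type} [Group G] [TopologicalSpace G] [IsTopologicalGroup G] [LocallyCompactSpace G]
    {D : Type} [Group D] [TopologicalSpace D] [IsTopologicalGroup D] [LocallyCompactSpace D]
    {X Y Z : TopRep R G} (P : ContPairing X Y Z) (N : Subgroup G) [N.Normal] (θ : D →ₜ* G)
    [Fintype (G ⧸ N)] [Fintype (D ⧸ N.comap (θ : D →* G))] (hN : IsOpen (N : Set G))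
    {s : G ⧸ N → G} (hs : ∀ y : G ⧸ N, (s y : G ⧸ N) = y) (hs1 : s ((1 : G) : G ⧸ N) = 1)
    {sD : D ⧸ N.comap (θ : D →* G) → D} (hsD : ∀ y, (sD y : D ⧸ N.comap (θ : D →* G)) = y)
    (hsD1 : sD ((1 : D) : D ⧸ N.comap (θ : D →* G)) = 1)
    {ι : Type} [Fintype ι] (t : ι → G)
    (hbij : Function.Bijective
      (fun q : (D ⧸ N.comap (θ : D →* G)) × ι ↦ (quotientMapOfHom N θ q.1) * (t q.2 : G ⧸ N)))
    (a : continuousCohomology 1 (subgroupRep X N)) (b : continuousCohomology 1 (subgroupRep Y N)) :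
    ContinuousCohomology.map θ (𝟙 (TopRep.res (θ : D →* G) Z)) 2
        ((P.coindFin N).cupProduct (shapiroLift X N hN hs hs1 a) (shapiroLift Y N hN hs hs1 b)) =
      ∑ i, ((P.restrict θ).coindFin (N.comap (θ : D →* G))).cupProduct
        (shapiroLift (TopRep.res (θ : D →* G) X) (N.comap (θ : D →* G)) (isOpen_comap N θ hN) hsD hsD1
          (ContinuousCohomology.map (comapSubtypeHom N θ) (comapCoeffHom X N θ) 1 (conjMap X N (t i) 1 a)))
        (shapiroLift (TopRep.res (θ : D →* G) Y) (N.comap (θ : D →* G)) (isOpen_comap N θ hN) hsD hsD1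
          (ContinuousCohomology.map (comapSubtypeHom N θ) (comapCoeffHom Y N θ) 1 (conjMap Y N (t i) 1 b))) := by
  sorry

/-- **(P3) the CORE `2 •` identity in invariant currency** (PLAN 3 = strongest provable form; PROVED here from (U), (ShU) and §B):
for a discrete `Γ_K`-module `M`, an open normal layer `U`, a pairing `Maps × Maps → μₙ` (`n` a `p`-power) and two layer cocycles
`ψ₁, ψ₂` whose conjugates are principal on inertia at every finite place outside `T`:
`2 • Σ_{v ∈ T} inv_v loc_v (Sh ψ₁ ∪ Sh ψ₂) = 0`.  The per-place evaluation of the `T`-terms (one coset at `2`, (M) at `w ∈ S₀`)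
is the lead's pins (C3)/(C5). [cite: MilneADT2006, Ch. I, Thm. 4.10(b)] [cite: NeukirchSchmidtWingberg2008, I §6 (1.6.4)] -/
theorem core_two_nsmul_sum_inv_cupProduct_shapiroLift {p : ℕ} [Fact p.Prime] (hn : ∃ r : ℕ, n = p ^ r)
    {M : Type} [AddCommGroup M] [TopologicalSpace M] [DiscreteTopology M] (ρ : DiscreteGaloisModule K M)
    (U : Subgroup (absoluteGaloisGroup K)) (hU : IsOpen (U : Set (absoluteGaloisGroup K)))
    [Fintype (absoluteGaloisGroup K ⧸ U)] [CompactSpace (absoluteGaloisGroup K)]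
    {s : absoluteGaloisGroup K ⧸ U → absoluteGaloisGroup K} (hs : ∀ x, (s x : absoluteGaloisGroup K ⧸ U) = x)
    (hs1 : s ((1 : absoluteGaloisGroup K) : absoluteGaloisGroup K ⧸ U) = 1)
    (P : ContPairing (ρ.coind U hU).toTopRep (ρ.coind U hU).toTopRep (mu K n).toTopRep)
    (T : Finset (HeightOneSpectrum (𝓞 K))) (ψ₁ ψ₂ : contOneCocycles (subgroupRep ρ.toTopRep U))
    (hinert : ∀ v : HeightOneSpectrum (𝓞 K), v ∉ T → ∀ ψ ∈ ({ψ₁, ψ₂} : Set (contOneCocycles (subgroupRep ρ.toTopRep U))),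
      ∀ y₀ : absoluteGaloisGroup K ⧸ U, ∃ b : M, ∀ i : absoluteGaloisGroup (v.adicCompletion K),
      i ∈ (IsNonarchimedeanLocalField.maxUnramified (v.adicCompletion K)).fixingSubgroup →
      ∀ hd : (s y₀)⁻¹ * absGaloisRestrict K (v.adicCompletion K) i * s y₀ ∈ U,
        ψ.1 ⟨(s y₀)⁻¹ * absGaloisRestrict K (v.adicCompletion K) i * s y₀, hd⟩ =
          ρ.toTopRep.ρ ((s y₀)⁻¹ * absGaloisRestrict K (v.adicCompletion K) i * s y₀) b - b) :
    2 • ∑ v ∈ T, localInvariantMap K n v (galoisCohomology.localization (mu K n) (Sum.inr v) 2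
      (P.cupProduct (shapiroLift ρ.toTopRep U hU hs hs1 (oneCocycleClass _ ψ₁))
        (shapiroLift ρ.toTopRep U hU hs hs1 (oneCocycleClass _ ψ₂)))) = 0 := by
  refine two_nsmul_sum_localInvariantMap_eq_zero K n T _ fun v hv ↦ ?_
  rw [helper_localization_cupProduct_eq_zero_of_unramified K n hn (ρ.coind U hU) (ρ.coind U hU) P v _ _
    (helper_localization_shapiroLift_mem_unramifiedSubgroup K ρ U hU hs hs1 v ψ₁ (hinert v hv ψ₁ (by simp)))
    (helper_localization_shapiroLift_mem_unramifiedSubgroup K ρ U hU hs hs1 v ψ₂ (hinert v hv ψ₂ (by simp))), map_zero]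

end Helpers

end Summit.BirchSwinnertonDyer.BirchSwinnertonDyer.Cruxes.ResidualThetaCountLowerPureAtTwo.StubIdeasK1G10

end
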